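import Literature.MathematicalPhysics.QuantumFieldTheory.Balaban1983to89.B7Eq136ThirdOrder
import Literature.MathematicalPhysics.QuantumFieldTheory.Balaban1983to89.B7Prop4GeneralCk

/-!
# `Balaban1983to89.B7Eq136Coefficients` — T. Bałaban, *Averaging operations for lattice gauge theories*, Commun. Math. Phys. **98** (1985)
17–51 [Balaban1985Averaging], (136)–(137) p. 39: **THE TERMS OF THE POWER SERIES OF PROPOSITION 4 ARE THE HOMOGENEOUS POLYNOMIALS
`C_k⁽ⁿ⁾(U₀, A)`** — for EVERY power series `p` of `A ↦ C_k(U₀, A)(c)` at `A = 0` on the finitely many variables `𝔸^S` (r04's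
`B7Prop4GeneralCk.prop4_general_Ck_powerSeries`: such a `p` exists, with `p₀ = p₁ = 0`), the `n`-th term on the diagonal is the `tⁿ`-coefficient of
the slice: `p_n(A, …, A) = (n!)⁻¹·(dⁿ/dtⁿ)C_k(U₀, tA)(c)|_{t=0}`; in particular `p₂(A, A) = C_k⁽²⁾(U₀, A)(c)` (`B7Eq136SecondOrder.CCovIter2`) and
`p₃(A, A, A) = C_k⁽³⁾(U₀, A)(c)` (`B7Eq136ThirdOrder.CCovIter3`) — the bridge between the two formalisations of (136) in the tree (r04: existence
of the expansion; p06: its terms, named and bounded)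

statement-level skeleton of published theorems with citation tags; proofs where landed; nothing here is a claim about the Yang–Mills mass gap

PDF held: `paper:balaban1985-cmp98-averaging` (journal page = PDF page + 16), renders `…/1985-cmp98-averaging-p022-x2.png`, `-p023-x2.png`
(pp. 38–39) read as images by this seat in gen 5 (cell `b2b-balaban-ref1` page renders).

CITATION HEADER / WHAT IS REPRODUCED.  Cell `lit-balaban`, Phase-2 proof seat p06 gen 6 = unit `lit-balaban-p06` (TAKING addendum HOME/STATUS.md
2026-08-21T18:10:42Z); SKELETON rows **B7.Prop4 / B7.Eq127** (display (136); owner r04).  THE PRINT.  p. 39: *«The function C_k can be decomposed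
further into a sum of homogeneous polynomials, C_k(U₀, A) = C_k^{(2)}(U₀, A) + C_k^{(3)}(U₀, A) + … . (136)»*; (137) *«dF(A, δA) = (d/dt)F(A +
tδA)|_{t=0}»*.  In the tree, r04 reads (136) as the EXISTENCE of a power series `p` at `0` with `p₀ = p₁ = 0` (`prop4_general_Ck_powerSeries`, the
function written `logCovIter − linCovIter` = `CCovIter` by definition (134)), and this seat reads the TERMS `C_k⁽ⁿ⁾` as the Taylor coefficients of
the complex slice `t ↦ C_k(U₀, tA)(c)` (`CCovIter2`, `CCovIter3`, and `CCovIterN` of `B7Eq136Series`).  This file proves the two readings agree: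
`p_n(A, …, A)` IS that coefficient, for every `p` (power series are unique) — by Mathlib's `HasFPowerSeriesOnBall.factorial_smul` («the iterated
derivative on `(y, …, y)` is `n!` times the `n`-th term») applied to the slice `p.compContinuousLinearMap (t ↦ tA)`.

DICTIONARY.  `C_k(U₀, A)(c)` on the variables `A ∈ 𝔸^S` ↦ `fun a : S → 𝔸 => CCovIter L U₀ (insCfg S a) k z κ` (`c = (z, κ)`; `insCfg` = zero off
`S`, `B7Prop3Flat`); `p_n(A, …, A)` ↦ `p n (fun _ => a)`; `C_k⁽ⁿ⁾(U₀, A)(c)` ↦ `(n!)⁻¹·(dⁿ/dtⁿ)C_k(U₀, t·ins_S a)(c)|₀` (= `B7Eq136Series.CCovIterN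
L U₀ (insCfg S a) k z κ n` by definition; `n = 2, 3`: `CCovIter2`, `CCovIter3`).  No regime hypothesis enters §1–§2 (pure consequences of having a
power series); §3 uses r04's regime (`L ≥ 2`, `AvgClosed`, (52) at level `k`, `C₀α₀ ≤ ⅓`, `4α₀ ≤ c₂′`, radius `ρ > 0` with Prop. 4's smallness).

WHAT THIS FILE PROVES (theorems only; kernel, 0 sorry, standard axioms):
* §1 (generic, private) `coeff_diag_eq_slice`: for `f` with a power series `p` at `0` and any vector `a`, `p n (a, …, a) = (n!)⁻¹·(dⁿ/dtⁿ)f(ta)|₀`.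
* §2 **THE BRIDGE**: **`powerSeries_diag_eq_slice_coeff`** (for every `p` with `HasFPowerSeriesAt (a ↦ C_j(U₀, ins_S a)(c)) p 0`, every `a`, `n`:
  `p n (fun _ => a) = (n!)⁻¹·(dⁿ/dtⁿ)C_j(U₀, t·ins_S a)(c)|₀`), **`powerSeries_diag_two`** (`p 2 (a, a) = C_j⁽²⁾(U₀, ins_S a)(c)`),
  **`powerSeries_diag_three`** (`p 3 (a, a, a) = C_j⁽³⁾(U₀, ins_S a)(c)`), `powerSeries_diag_unique` (two power series agree on every diagonal).
* §3 **(136) WITH ITS TERMS NAMED, AT A GENERAL BACKGROUND**: `prop4_general_Ck_powerSeries_terms` — r04's `prop4_general_Ck_powerSeries` restated for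
  `CCovIter` with the identification of §2: `∃ p`, power series of `C_k(U₀, ins_S ·)(c)` at `0`, `p₀ = 0`, `p₁ = 0`, and for every `a`:
  `p₂(a, a) = CCovIter2 …`, `p₃(a, a, a) = CCovIter3 …`, `p n (a, …, a) = (n!)⁻¹(dⁿ/dtⁿ)C_k(U₀, t·ins_S a)(c)|₀`.
NOT CLAIMED: anything about the off-diagonal values of `p_n` beyond what symmetry/polarization gives (`B7Eq136SecondOrder`, `B7Eq136ThirdPolarization`);
convergence radii (`B7Eq136Series`).  NOT summit progress.
-/

noncomputable section

open scoped BigOperators Topology Nat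
open NormedSpace Finset Metric Filter

namespace Literature.MathematicalPhysics.QuantumFieldTheory.Balaban1983to89.B7Eq136Coefficients

open B7Prop1Explicit B7Prop1Local B7Prop2Explicit B7Prop3Flat B7Prop4Flat B7Eq92Concrete B7Prop3GeneralLinear
  B7Prop4GeneralLevels B7Prop5GeneralInduction B7Prop5GeneralLevels B7Eq136SecondOrder B7Eq136ThirdOrder B7Prop4GeneralCk

-- `Site` alone would resolve to the torus sites of `Setup.lean`; re-export the `ℤ^d` sites of `B7Prop1Explicit`.
export B7Prop1Explicit (Site)

variable {d : ℕ}

/-! ## §1 Taylor terms on the diagonal are slice derivatives (generic, private) -/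

section Generic

variable {E F : Type*} [NormedAddCommGroup E] [NormedSpace ℂ E] [NormedAddCommGroup F] [NormedSpace ℂ F] [CompleteSpace F]

/-- for `f` with a power series `p` at `0` and any vector `a`: `p n (a, …, a) = (n!)⁻¹·(dⁿ/dtⁿ)f(t·a)|_{t=0}` — the slice `t ↦ f(ta)` has the power
series `p.compContinuousLinearMap (t ↦ ta)`, whose `n`-th term on `(1, …, 1)` is `p n (a, …, a)`, and Mathlib's
`HasFPowerSeriesOnBall.factorial_smul` identifies `n!` times it with the `n`-th derivative. [folklore] -/
private theorem coeff_diag_eq_slice {f : E → F} {p : FormalMultilinearSeries ℂ E F} (hp : HasFPowerSeriesAt f p 0) (a : E) (n : ℕ) :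
    p n (fun _ => a) = ((n ! : ℕ) : ℂ)⁻¹ • iteratedDeriv n (fun t : ℂ => f (t • a)) 0 := by
  obtain ⟨r, hr⟩ := hp
  set u : ℂ →L[ℂ] E := ContinuousLinearMap.toSpanSingleton ℂ a with hu
  have hu0 : u 0 = 0 := by simp [hu]
  have hr' : HasFPowerSeriesOnBall f p (u 0) r := by rwa [hu0]
  have hg := hr'.compContinuousLinearMap
  have h1 := hg.factorial_smul (1 : ℂ) n
  rw [FormalMultilinearSeries.compContinuousLinearMap_apply, iteratedFDeriv_apply_eq_iteratedDeriv_mul_prod,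
    Finset.prod_const_one, one_smul] at h1
  have hcomp : (u ∘ fun _ : Fin n => (1 : ℂ)) = fun _ => a := by
    funext i
    simp [hu]
  have hfun : (f ∘ u) = fun t : ℂ => f (t • a) := by
    funext t
    simp [hu]
  rw [hcomp, hfun] at h1
  rw [← h1, ← Nat.cast_smul_eq_nsmul ℂ, smul_smul, inv_mul_cancel₀ (by exact_mod_cast (Nat.factorial_ne_zero n)), one_smul]

end Generic

/-! ## §2 The bridge: `p_n(A, …, A) = C_j⁽ⁿ⁾(U₀, A)(c)` -/

section Bridge

variable {𝔸 : Type*} [NormedRing 𝔸] [NormedAlgebra ℂ 𝔸] [CompleteSpace 𝔸]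

/-- **THE `n`-TH TERM OF ANY POWER SERIES OF `C_j(U₀, ·)(c)` AT `0`, ON THE DIAGONAL, IS THE `tⁿ`-COEFFICIENT OF THE SLICE**: for every `p` with
`C_j(U₀, ins_S a)(c) = Σ_n p_n(a, …, a)` near `a = 0` and every `a ∈ 𝔸^S`, `p_n(a, …, a) = (n!)⁻¹·(dⁿ/dtⁿ)C_j(U₀, t·ins_S a)(c)|_{t=0}` — the
homogeneous polynomial «C_k^{(n)}(U₀, A)» of (136) computed by the differential calculus of (137) (= `B7Eq136Series.CCovIterN L U₀ (insCfg S a) j z κ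
n`). No regime hypothesis: a consequence of having a power series at all. [cite: Balaban1985Averaging, (136) p.39, (137) p.39] -/
theorem powerSeries_diag_eq_slice_coeff (S : Finset (Site d × Fin d)) (L : ℕ) (U₀ : Site d → Fin d → 𝔸ˣ) (j : ℕ) (z : Site d) (κ : Fin d)
    {p : FormalMultilinearSeries ℂ (S → 𝔸) 𝔸} (hp : HasFPowerSeriesAt (fun a : S → 𝔸 => CCovIter L U₀ (insCfg S a) j z κ) p 0)
    (a : S → 𝔸) (n : ℕ) :
    p n (fun _ => a) = ((n ! : ℕ) : ℂ)⁻¹ • iteratedDeriv n (fun t : ℂ => CCovIter L U₀ (t • insCfg S a) j z κ) 0 := by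
  have h := coeff_diag_eq_slice hp a n
  simpa only [insCfg_smul] using h

/-- **`p₂(A, A) = C_j⁽²⁾(U₀, A)(c)`**: the second term of any power series of `C_j(U₀, ins_S ·)(c)` at `0` is, on the diagonal, the second-order
term of (136) (`B7Eq136SecondOrder.CCovIter2`). [cite: Balaban1985Averaging, (136) p.39] -/
theorem powerSeries_diag_two (S : Finset (Site d × Fin d)) (L : ℕ) (U₀ : Site d → Fin d → 𝔸ˣ) (j : ℕ) (z : Site d) (κ : Fin d)
    {p : FormalMultilinearSeries ℂ (S → 𝔸) 𝔸} (hp : HasFPowerSeriesAt (fun a : S → 𝔸 => CCovIter L U₀ (insCfg S a) j z κ) p 0)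
    (a : S → 𝔸) : p 2 (fun _ => a) = CCovIter2 L U₀ (insCfg S a) j z κ := by
  rw [powerSeries_diag_eq_slice_coeff S L U₀ j z κ hp a 2, CCovIter2_def]
  norm_num [Nat.factorial]

/-- **`p₃(A, A, A) = C_j⁽³⁾(U₀, A)(c)`**: the third term of any power series of `C_j(U₀, ins_S ·)(c)` at `0` is, on the diagonal, the third-order
term of (136) (`B7Eq136ThirdOrder.CCovIter3`). [cite: Balaban1985Averaging, (136) p.39] -/
theorem powerSeries_diag_three (S : Finset (Site d × Fin d)) (L : ℕ) (U₀ : Site d → Fin d → 𝔸ˣ) (j : ℕ) (z : Site d) (κ : Fin d)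
    {p : FormalMultilinearSeries ℂ (S → 𝔸) 𝔸} (hp : HasFPowerSeriesAt (fun a : S → 𝔸 => CCovIter L U₀ (insCfg S a) j z κ) p 0)
    (a : S → 𝔸) : p 3 (fun _ => a) = CCovIter3 L U₀ (insCfg S a) j z κ := by
  rw [powerSeries_diag_eq_slice_coeff S L U₀ j z κ hp a 3, CCovIter3_def]

/-- the diagonal values `p_n(A, …, A)` — the homogeneous polynomials of (136) — do not depend on the chosen power series.
[cite: Balaban1985Averaging, (136) p.39] -/
theorem powerSeries_diag_unique (S : Finset (Site d × Fin d)) (L : ℕ) (U₀ : Site d → Fin d → 𝔸ˣ) (j : ℕ) (z : Site d) (κ : Fin d)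
    {p q : FormalMultilinearSeries ℂ (S → 𝔸) 𝔸} (hp : HasFPowerSeriesAt (fun a : S → 𝔸 => CCovIter L U₀ (insCfg S a) j z κ) p 0)
    (hq : HasFPowerSeriesAt (fun a : S → 𝔸 => CCovIter L U₀ (insCfg S a) j z κ) q 0) (a : S → 𝔸) (n : ℕ) :
    p n (fun _ => a) = q n (fun _ => a) := by
  rw [powerSeries_diag_eq_slice_coeff S L U₀ j z κ hp a n, powerSeries_diag_eq_slice_coeff S L U₀ j z κ hq a n]

end Bridge

/-! ## §3 (136) at a general background with its terms named -/

section Regime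

variable {𝔸 : Type*} [NormedRing 𝔸] [NormedAlgebra ℂ 𝔸] [CompleteSpace 𝔸] [NormOneClass 𝔸]

/-- **(136) AT A GENERAL REGULAR BACKGROUND, EXISTENCE AND TERMS**: in the regime of r04's `B7Prop4GeneralCk.prop4_general_Ck_powerSeries` (`L ≥ 2`,
structure group closed under averaging, (52) `pdev U₀ < α₀L^{−2k}`, `C₀α₀ ≤ ⅓`, `4α₀ ≤ c₂′`, a radius `ρ > 0` with Prop. 4's smallness), the functional
`A ↦ C_k(U₀, A)(c)` on `𝔸^S` has a power series `p` at `0` with `p₀ = 0`, `p₁ = 0` (r04), AND its terms on the diagonal are the homogeneous polynomials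
of (136): `p₂(A, A) = C_k⁽²⁾(U₀, A)(c)`, `p₃(A, A, A) = C_k⁽³⁾(U₀, A)(c)`, `p_n(A, …, A) = (n!)⁻¹(dⁿ/dtⁿ)C_k(U₀, tA)(c)|₀` for every `n` — «C_k(U₀, A) =
C_k^{(2)}(U₀, A) + C_k^{(3)}(U₀, A) + …». [cite: Balaban1985Averaging, (136) p.39, Prop. 4 p.38] -/
theorem prop4_general_Ck_powerSeries_terms (S : Finset (Site d × Fin d)) (L : ℕ) (hL : 2 ≤ L) {G : Subgroup 𝔸ˣ}
    (hG : AvgClosed d L G) (k : ℕ) (U₀ : Site d → Fin d → 𝔸ˣ) (hU₀ : ∀ x κ, U₀ x κ ∈ G) {α₀ : ℝ}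
    (hα : 0 < α₀) (hα3 : C0 d * α₀ ≤ 1 / 3) (hα4 : 4 * α₀ ≤ c2' d L) (h52 : pdev U₀ < α₀ * (((L : ℝ) ^ k)⁻¹) ^ 2)
    {ρ : ℝ} (hρ : 0 < ρ)
    (hρsmall : Real.exp (4 * (800 * ((d : ℝ) + 1) ^ 2 * ((d : ℝ) + 4)) * α₀)
      * (1 + 8 * (131072 * ((d : ℝ) + 1) ^ 2) * ((L : ℝ) ^ k * ρ)) ≤ 2)
    (hρc₃ : 2 * ((L : ℝ) ^ k * ρ) ≤ c3 d L) (z : Site d) (κ : Fin d) :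
    ∃ p : FormalMultilinearSeries ℂ (S → 𝔸) 𝔸,
      HasFPowerSeriesAt (fun a : S → 𝔸 => CCovIter L U₀ (insCfg S a) k z κ) p 0 ∧ p 0 = 0 ∧ p 1 = 0 ∧
        ∀ a : S → 𝔸, p 2 (fun _ => a) = CCovIter2 L U₀ (insCfg S a) k z κ ∧
          p 3 (fun _ => a) = CCovIter3 L U₀ (insCfg S a) k z κ ∧
          ∀ n : ℕ, p n (fun _ => a) = ((n ! : ℕ) : ℂ)⁻¹ • iteratedDeriv n (fun t : ℂ => CCovIter L U₀ (t • insCfg S a) k z κ) 0 := by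
  obtain ⟨p, hp, h0, h1⟩ := prop4_general_Ck_powerSeries S L hL hG k U₀ hU₀ hα hα3 hα4 h52 hρ hρsmall hρc₃ z κ
  have hp' : HasFPowerSeriesAt (fun a : S → 𝔸 => CCovIter L U₀ (insCfg S a) k z κ) p 0 := hp
  exact ⟨p, hp', h0, h1, fun a => ⟨powerSeries_diag_two S L U₀ k z κ hp' a, powerSeries_diag_three S L U₀ k z κ hp' a,
    fun n => powerSeries_diag_eq_slice_coeff S L U₀ k z κ hp' a n⟩⟩

end Regime

end Literature.MathematicalPhysics.QuantumFieldTheory.Balaban1983to89.B7Eq136Coefficients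

end
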